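import Literature.AnabelianGeometry.SemiGraphs.ArithBranchActionConsequences
import Literature.AnabelianGeometry.SemiGraphs.ArithIntersectionOfActionAt
import Literature.AnabelianGeometry.SemiGraphs.ArithLevelDataThm54
import Literature.AnabelianGeometry.SemiGraphs.ArithChartActionAmple
import Literature.AnabelianGeometry.SemiGraphs.ArithMaximalCompactThm54iiOfChart
import Literature.AnabelianGeometry.SemiGraphs.TemperedCompactInVerticialAtBridge
import HarnessLib

/-!
# [SemiAnbd] Thm 5.4 (i) ∧ (ii) for the PRODUCED decomposition data over the branch-granular chart action

Mochizuki, *Semi-graphs of anabelioids*, Publ. RIMS **42** (2006) 221–322, §5, Thm 5.4 (i)(ii) p. 66,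
for the decomposition data `Π^temp_{𝔊,v}`, `Π^temp_{𝔊,b}` of p. 65; Def 5.1 (i) p. 62; Rmk 5.3.1 p. 65.
[cite: MochizukiSemiAnbd2006, Thm 5.4 (i)(ii), p. 66]

PROOF-ONLY umbrella v2 (abc-iut cell, L3 sub-DAG `plan/L3/SUBDAG-SemiAnbd-Thm54.md`, seat
abc-iut-w4-d040, piece (c3) of the LEVEL-A programme; producer package = abc-iut-w4-d053's
`ArithChartBranchAction`).  No definition, no new named fact.  The umbrellas of record —
`arithMaximalCompactStatementI_and_II_ofChartAt` (this seat; via the arithmetic level data `L`) and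
abc-iut-w4-d085's `arithMaximalCompactStatementII_ofChartAction` (via Thm 5.4 (i) `hI`) — are re-issued
with the LEVEL-A binders `hconjPair` (Rmk 5.3.1 first sentence) and `hcommB`/`hCE` (p. 65, "the
commensurator in `Π^temp_{𝔊,v}` of `Π^temp_{𝔾,b}`") DISCHARGED from the package
(`ArithBranchActionConsequences.lean`):

* `ArithChartBranchAction.hcommB_At` — menu item hcomm_b for EVERY branch of a graph of anabelioids;
* **`arithMaximalCompactStatementI_and_II_ofChart_of_branchActionAt`** — Thm 5.4 (i) ∧ (ii) for
  `decompositionDataOfChart R ι`, CONDITIONAL on: the packages `L : ArithLevelData …` (trees / actions /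
  dictionary, producer debt T54-B) and `A : ArithChartBranchAction …` (Def 5.1 (i) on the chart, branch
  form), the LEVEL-B compactness `hVc`/`hBc` of the produced groups, Thm 3.7 (iii) at `𝒢`
  (`CompactInVerticialAt 𝒢`), and the print hypotheses `Thm37Hypotheses`/`IsGraph`, total arithmetic
  estrangement `hest`, `hbot` ("`Π_A` not discrete"), Prop 5.2 (iv) (`hι`, `hexact`, `hsurj`);
* `arithMaximalCompactStatementI_and_II_ofChart_of_branchAction_of_finiteLevelData` — the same with
  Thm 3.7 (iii) supplied by finite-level data at one chart (abc-iut-w4-d075's bridge);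
* **`arithMaximalCompactStatementII_ofChart_of_branchAction`** — abc-iut-w4-d085's route ((ii) from (i)
  `hI`) with `hconjPair`, `hcommB`, `hCE` discharged; residual: `hI`, `hVc`, `hBc`, no switching of
  branches (`NoBranchSwitching 𝒢.graph.edgeOf actB`, print's Thm 5.4 hypothesis), `CompactInVerticial`,
  and the Prop 5.2 (iv) data.

Nothing here takes a side on [IUTchIII] Cor. 3.12; typed ≠ proved for the packages themselves.
-/

namespace Literature.AnabelianGeometry.SemiGraphs

namespace ProfiniteSemiGraph

open CategoryTheory Topology
open scoped Pointwise

universe v u u''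

variable {𝒢 : ProfiniteSemiGraph.{u}} {c : TemperedPiChart 𝒢}
  {Gtp : Type u} [Group Gtp] [TopologicalSpace Gtp]
  {PA : Type u''} [Group PA] [TopologicalSpace PA]
  {ι : c.G →* Gtp} {aug : Gtp →* PA}
  {actV : PA → 𝒢.graph.Vertex → 𝒢.graph.Vertex} {actE : PA → 𝒢.graph.Edge → 𝒢.graph.Edge}
  {actB : PA → 𝒢.graph.Branch → 𝒢.graph.Branch}

omit [TopologicalSpace Gtp] in
/-- **Menu item hcomm_b for EVERY branch** of a graph of anabelioids (every branch abuts), for the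
produced data over `ArithChartBranchAction`: `C(Π^temp_{𝔊,b} ∩ Ker aug) = Π^temp_{𝔊,b}` — modulo no
switching of branches and Thm 3.7 (iii) at `𝒢`. [cite: MochizukiSemiAnbd2006, §5 p. 65] -/
theorem ArithChartBranchAction.hcommB_At (A : ArithChartBranchAction c ι aug actV actE actB)
    (h : CompactInVerticialAt 𝒢) (h𝒢 : 𝒢.Thm37Hypotheses) (hG : 𝒢.graph.IsGraph)
    (R : ChartRepresentatives c) (hι : Function.Injective ι) (hexact : ι.range = aug.ker)
    (hns : NoBranchSwitching 𝒢.graph.edgeOf actB) (b : 𝒢.graph.Branch) :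
    Subgroup.Commensurable.commensurator ((decompositionDataOfChart R ι).brGp b ⊓ aug.ker) =
      (decompositionDataOfChart R ι).brGp b := by
  obtain ⟨v, hb⟩ := Option.isSome_iff_exists.mp (hG.abuts_isSome b)
  rw [decompositionDataOfChart_brGp]
  exact A.commensurator_arithBrGp_inf_kerAt h h𝒢 hG hι hexact.symm hns R hb

/-- **[SemiAnbd] Thm 5.4 (i) ∧ (ii) for the PRODUCED decomposition data over the branch-granular
chart action, AT ONE GRAPH** — `arithMaximalCompactStatementI_and_II_ofChartAt` with `hconjPair`
DISCHARGED by (c1) `ArithChartBranchAction.hconjPair`.  CONDITIONAL on the packages `L`, `A`, on the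
LEVEL-B compactness `hVc`, `hBc`, on `CompactInVerticialAt 𝒢`, and on the print hypotheses (see the
module docstring). [cite: MochizukiSemiAnbd2006, Thm 5.4 (i)(ii), p. 66] -/
theorem arithMaximalCompactStatementI_and_II_ofChart_of_branchActionAt [IsTopologicalGroup Gtp]
    [T2Space Gtp] [IsTopologicalGroup PA] (h : CompactInVerticialAt 𝒢)
    (h𝒢 : 𝒢.Thm37Hypotheses) (hG : 𝒢.graph.IsGraph) (R : ChartRepresentatives c)
    (hι : Function.Injective ι) (hexact : ι.range = aug.ker) (hsurj : Function.Surjective aug)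
    {baseAct : PA →* Aut 𝒢.graph} (L : ArithLevelData 𝒢.graph (decompositionDataOfChart R ι) aug baseAct)
    (A : ArithChartBranchAction c ι aug actV actE actB)
    (hest : IsTotallyArithEstranged (decompositionDataOfChart R ι) aug) (hbot : ¬ IsArithAmple aug ⊥)
    (hVc : ∀ v, IsCompact (arithVertGp R ι v : Set Gtp))
    (hBc : ∀ b, IsCompact (arithBrGp R ι b : Set Gtp)) :
    ArithMaximalCompactStatementI (decompositionDataOfChart R ι) aug ∧
      ArithMaximalCompactStatementII (decompositionDataOfChart R ι) aug := by
  have habuts := abut_isSome_of_isGraph R ι hG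
  have hιaug : ∀ h : c.G, aug (ι h) = 1 := fun h => by
    rw [← MonoidHom.mem_ker, ← hexact]; exact ⟨h, rfl⟩
  -- Rmk 5.3.1, first sentence, at LEVEL A (row T54-1), `hconjPair` supplied by (c1)
  have hR : VerticialEdgeLikeCompactAmpleStatement (decompositionDataOfChart R ι) aug :=
    A.toArithChartAction.verticialEdgeLikeCompactAmple R hιaug hsurj hG
      (fun b v hb => A.hconjPair h h𝒢 hG R hsurj b v hb) hVc hBc
  exact ⟨L.arithMaximalCompactStatementI_of habuts hest hbot,
    L.arithMaximalCompactStatementII_of habuts hest hbot hR fun _ hK =>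
      not_isEdgeLike_of_isVerticial_ofChart_of_actionAt h h𝒢 hG R ι hι aug hexact
        A.toArithChartAction hK⟩

/-- **The same with Thm 3.7 (iii) supplied by FINITE-LEVEL DATA at one chart** (abc-iut-w4-d075's bridge
`compactInVerticialAt_of_finiteLevelData`; print p. 41 "since the semi-graphs `𝔾_j` are all finite").
[cite: MochizukiSemiAnbd2006, Thm 5.4 (i)(ii), p. 66] -/
theorem arithMaximalCompactStatementI_and_II_ofChart_of_branchAction_of_finiteLevelData
    [IsTopologicalGroup Gtp] [T2Space Gtp] [IsTopologicalGroup PA]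
    (hD : ∃ c₀ : TemperedPiChart 𝒢, Nonempty (FiniteLevelData.{v} 𝒢 c₀))
    (h𝒢 : 𝒢.Thm37Hypotheses) (hG : 𝒢.graph.IsGraph) (R : ChartRepresentatives c)
    (hι : Function.Injective ι) (hexact : ι.range = aug.ker) (hsurj : Function.Surjective aug)
    {baseAct : PA →* Aut 𝒢.graph} (L : ArithLevelData 𝒢.graph (decompositionDataOfChart R ι) aug baseAct)
    (A : ArithChartBranchAction c ι aug actV actE actB)
    (hest : IsTotallyArithEstranged (decompositionDataOfChart R ι) aug) (hbot : ¬ IsArithAmple aug ⊥)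
    (hVc : ∀ v, IsCompact (arithVertGp R ι v : Set Gtp))
    (hBc : ∀ b, IsCompact (arithBrGp R ι b : Set Gtp)) :
    ArithMaximalCompactStatementI (decompositionDataOfChart R ι) aug ∧
      ArithMaximalCompactStatementII (decompositionDataOfChart R ι) aug :=
  arithMaximalCompactStatementI_and_II_ofChart_of_branchActionAt (compactInVerticialAt_of_finiteLevelData hD)
    h𝒢 hG R hι hexact hsurj L A hest hbot hVc hBc

/-- **[SemiAnbd] Thm 5.4 (ii) for the produced data from (i), over the branch-granular chart action** —
abc-iut-w4-d085's `arithMaximalCompactStatementII_ofChartAction` with its LEVEL-A binders `hconjPair`,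
`hcommB`, `hCE` DISCHARGED by (c1)/(c2).  Residual: Thm 5.4 (i) `hI` for the produced data, the
LEVEL-B compactness `hVc`/`hBc`, no switching of branches (print's Thm 5.4 hypothesis, for the action of
`Π_A` on the underlying semi-graph), `CompactInVerticial` (Thm 3.7 (iii)), Prop 5.2 (iv) data.
[cite: MochizukiSemiAnbd2006, Thm 5.4 (ii), p. 66] -/
theorem arithMaximalCompactStatementII_ofChart_of_branchAction [T2Space Gtp] [IsTopologicalGroup Gtp]
    [IsTopologicalGroup PA] (hCV : CompactInVerticial.{u})
    (h𝒢 : 𝒢.Thm37Hypotheses) (hG : 𝒢.graph.IsGraph) (R : ChartRepresentatives c)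
    (hι : Function.Injective ι) (hexact : ι.range = aug.ker) (hsurj : Function.Surjective aug)
    (A : ArithChartBranchAction c ι aug actV actE actB)
    (hns : NoBranchSwitching 𝒢.graph.edgeOf actB)
    (hVc : ∀ v, IsCompact (arithVertGp R ι v : Set Gtp))
    (hBc : ∀ b, IsCompact (arithBrGp R ι b : Set Gtp))
    (hI : ArithMaximalCompactStatementI (decompositionDataOfChart R ι) aug) :
    Literature.AnabelianGeometry.SemiGraphs.ArithMaximalCompactStatementII
      (decompositionDataOfChart R ι) aug :=
  arithMaximalCompactStatementII_ofChartAction hCV h𝒢 hG R ι hι aug hexact hsurj A.toArithChartAction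
    (fun b v hb => A.hconjPair (hCV 𝒢) h𝒢 hG R hsurj b v hb) hVc hBc hI
    (A.hcommB_At (hCV 𝒢) h𝒢 hG R hι hexact hns)
    (fun _ _ _ _ hL hH hLH =>
      A.commensurator_map_le_of_edgeLike_le_verticialAt (hCV 𝒢) h𝒢 hG hι hns hL hH hLH)

end ProfiniteSemiGraph

end Literature.AnabelianGeometry.SemiGraphs
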